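import Summits.QuantumFields.YangMills.Theorems.SwapTwistDeficitPeriodicRingFloorBoxMass
import Summits.QuantumFields.YangMills.Theorems.LuscherReductionRunningReductionWindowMass
import HarnessLib

/-!
# The SHARP periodic floor of the zero-flux ring at every fixed `L`: `μ_L{F₀ ≤ t} ≥ c_L·t^{9L⁴−3/2}`,
# `∫e^{−βF₀}dμ_L ≥ c_L·β^{−(9L⁴−3/2)}`, `TT.physTrace L β (2L) ≥ (c_L/8)·e^{12βL⁴}·β^{−(9L⁴−3/2)}`
# (free-hands support of item stmt-QuantumFields-23802 `SwapTwistDeficit.TwistRatioVanishesFixedL`; file 3 of 3 of brick (A0) of the fixed-`L` reduction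
# memo of seat w2 g54)

From the toron-box mass ✓`ballVol_pow_le_ringMeasure_real_deficit_le` (`ballVol(t₁)⁴·ballVol(t₂)^{6L⁴−3} ≤ μ_L{F₀ ≤ 400L⁴t₂²}`) and the small-ball
volume ✓`ballVol_ge_threeHalves`:

* §2 `pow_three_div_le_ballVol` (`r³/34 ≤ ballVol r` on `[0, 2]`) and the power count `(t₁³)⁴·(t₂³)^{6L⁴−3} = (t/(400L⁴))^{9L⁴−3/2}` for
  `t₂ = √(t/(400L⁴))`, `t₁ = √t₂`;
* §3 ★★ `sharp_volume_floor` — `(1/34)^{6L⁴+1}·(t/(400L⁴))^{9L⁴−3/2} ≤ (ringMeasure L).real {F₀ ≤ t}` for `0 < t ≤ 400L⁴`, and its `∃ c_L > 0` form on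
  `(0, 1]`; ★★ `sharp_laplace_floor` — `e^{−1}(1/34)^{6L⁴+1}(400L⁴β)^{−(9L⁴−3/2)} ≤ ∫e^{−βF₀}dμ_L` for `β ≥ 1`;
  ★★ `sharp_physTrace_floor` — `(1/8)·e^{12βL⁴}·(that) ≤ TT.physTrace L β (2L)` (✓`physTraceSucc_eq_sum_sectorWeight`,
  ✓`sectorWeight_eq_exp_mul_integral_deficit`; the seven twisted sectors are `≥ 0`).

The exponent `9L⁴ − 3/2` is the true one (against the crude `12L⁴ + 2L³` of ✓`VirialFluxGapPeriodicVolumeFloor`); the logarithmic factor `log t⁻¹` of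
the full volume law (the commuting-holonomy cone ties with the box at the central torons) is NOT claimed here.
HONEST FRAMING: the cheap direction (a floor) of a fixed-`L` Laplace asymptotic for a support item of a DRAFT line; ⟨23802⟩ as typed also needs a CEILING
for the swap-twisted trace at small `L`; no crux, rung or summit statement is proved; the Yang–Mills mass gap is NOT proved; no summit is proved by a line.
THEOREMS ONLY (0 `def`, 0 `sorry`), standard axioms.  Width seat ym-line-sfw-p2-w3 g61 (cell ym-idea-1, free hands), `--supports stmt-QuantumFields-23802`.
References: [cite: Luscher1983, §2]; [cite: Vanbaal2001]; [cite: Chatterjee2016, Lemma 9.3]; [cite: MontvayMunster1994, (3.145)].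
-/

set_option autoImplicit false

noncomputable section

open MeasureTheory
open scoped BigOperators ENNReal
open Literature.MathematicalPhysics.QuantumFieldTheory hiding SU2
open Literature.MathematicalPhysics.QuantumLattice
open Summit.QuantumFields.YangMills.Theorems.FemtoTransferGap
open Summit.QuantumFields.YangMills.Theorems.FemtoTransferGap.TT
open Summit.QuantumFields.YangMills.Theorems.VirialFluxGap.RingDeficit
open Summit.QuantumFields.YangMills.Theorems.VirialFluxGap.TreeGaugeTransfer (measureReal_deficit_le_eq_fix)

namespace Summit.QuantumFields.YangMills.Theorems.SwapTwistDeficit.PeriodicRingFloor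

variable {L : ℕ} [NeZero L]

/-! ## §2 Small Hilbert–Schmidt balls and the power count -/

/-- `r³/34 ≤ ballVol r` for `0 ≤ r ≤ 2` (✓`ballVol_ge_threeHalves`: `ballVol r ≥ 8/(3π³)·(r²/2)·√(r²/2) = 4r³/(3√2π³)`, and
`3√2π³ ≤ 136`). [folklore] -/
theorem pow_three_div_le_ballVol {r : ℝ} (hr0 : 0 ≤ r) (hr : r ≤ 2) : r ^ 3 / 34 ≤ ballVol r := by
  have h := ballVol_ge_threeHalves hr0 hr
  have hs : Real.sqrt (r ^ 2 / 2) = r / Real.sqrt 2 := by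
    rw [Real.sqrt_div (sq_nonneg r), Real.sqrt_sq hr0]
  rw [hs] at h
  have hπ0 : 0 < Real.pi := Real.pi_pos
  have hπ3 : Real.pi ^ 3 ≤ 32 := by
    have h1 := Real.pi_lt_d2
    nlinarith [mul_pos hπ0 hπ0]
  have h2 : Real.sqrt 2 ≤ 17 / 12 := by
    rw [Real.sqrt_le_left (by norm_num)]; norm_num
  have hs0 : 0 < Real.sqrt 2 := by positivity
  have hprod : Real.sqrt 2 * Real.pi ^ 3 ≤ 136 / 3 := by nlinarith [pow_pos hπ0 3]
  -- `8/(3π³) · (r²/2) · (r/√2) = r³ · (4 / (3·√2·π³)) ≥ r³/34`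
  have e : 8 / (3 * Real.pi ^ 3) * (r ^ 2 / 2 * (r / Real.sqrt 2)) = r ^ 3 * (4 / (3 * (Real.sqrt 2 * Real.pi ^ 3))) := by
    field_simp; ring
  rw [e] at h
  have hc : 1 / 34 ≤ 4 / (3 * (Real.sqrt 2 * Real.pi ^ 3)) := by
    rw [div_le_div_iff₀ (by norm_num) (by positivity)]; nlinarith
  have hr3 : 0 ≤ r ^ 3 := by positivity
  calc r ^ 3 / 34 = r ^ 3 * (1 / 34) := by ring
    _ ≤ r ^ 3 * (4 / (3 * (Real.sqrt 2 * Real.pi ^ 3))) := mul_le_mul_of_nonneg_left hc hr3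
    _ ≤ ballVol r := h

omit [NeZero L] in
/-- The power count of the box: for `K > 0`, `0 ≤ t`, `t₂ = √(t/K)`, `t₁ = √t₂`:
`(t₁³)⁴ · (t₂³)^{6L⁴−3} = (t/K)^{9L⁴ − 3/2}`. [folklore] -/
theorem pow_count {K t : ℝ} (hK : 0 < K) (ht : 0 ≤ t) (hL : 1 ≤ L) :
    (Real.sqrt (Real.sqrt (t / K)) ^ 3) ^ 4 * (Real.sqrt (t / K) ^ 3) ^ (6 * L ^ 4 - 3) =
      (t / K) ^ (9 * (L : ℝ) ^ 4 - 3 / 2) := by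
  have hx : 0 ≤ t / K := div_nonneg ht hK.le
  set x : ℝ := t / K with hxdef
  have h3 : 3 ≤ 6 * L ^ 4 := by nlinarith [Nat.one_le_pow 4 L hL]
  -- everything as real powers of `x`
  have e1 : (Real.sqrt (Real.sqrt x) ^ 3) ^ 4 = x ^ (3 : ℝ) := by
    rw [← pow_mul, show 3 * 4 = 2 * (2 * 3) by norm_num, pow_mul, Real.sq_sqrt (Real.sqrt_nonneg _), pow_mul,
      Real.sq_sqrt hx]
    norm_cast
  have e2 : (Real.sqrt x ^ 3) ^ (6 * L ^ 4 - 3) = x ^ (((3 * (6 * L ^ 4 - 3) : ℕ) : ℝ) / 2) := by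
    rw [← pow_mul, Real.sqrt_eq_rpow, ← Real.rpow_natCast, ← Real.rpow_mul hx]
    congr 1; ring
  rw [e1, e2, ← Real.rpow_add' hx]
  · congr 1
    rw [Nat.cast_mul, Nat.cast_sub h3]; push_cast; ring
  · rw [Nat.cast_mul, Nat.cast_sub h3]; push_cast; nlinarith [show (1 : ℝ) ≤ (L : ℝ) ^ 4 from by exact_mod_cast Nat.one_le_pow 4 L hL]

/-! ## §3 The sharp floors -/

/-- ★★ **SHARP PERIODIC VOLUME FLOOR**: for every `L ≥ 1` and `0 < t ≤ 400·L⁴`,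
`(1/34)^{6L⁴+1} · (t/(400L⁴))^{9L⁴−3/2} ≤ (ringMeasure L).real {F₀ ≤ t}` — the exponent `9L⁴ − 3/2` is the true one (`18L⁴ − 3` massive directions
of the periodic toron valley); only the logarithmic factor of the commuting-holonomy cone is not claimed. [cite: Luscher1983, §2] [cite: Vanbaal2001] -/
theorem sharp_volume_floor {t : ℝ} (ht0 : 0 < t) (ht : t ≤ 400 * (L : ℝ) ^ 4) :
    (1 / 34 : ℝ) ^ (6 * L ^ 4 + 1) * (t / (400 * (L : ℝ) ^ 4)) ^ (9 * (L : ℝ) ^ 4 - 3 / 2) ≤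
      (ringMeasure L).real {P | ringDeficit L (fun _ => false) P ≤ t} := by
  have hL1 : 1 ≤ L := NeZero.one_le
  have hL : (0 : ℝ) < L := by exact_mod_cast NeZero.pos L
  have hK : (0 : ℝ) < 400 * (L : ℝ) ^ 4 := by positivity
  set t₂ : ℝ := Real.sqrt (t / (400 * (L : ℝ) ^ 4)) with ht₂
  set t₁ : ℝ := Real.sqrt t₂ with ht₁
  have hx1 : t / (400 * (L : ℝ) ^ 4) ≤ 1 := by rw [div_le_one hK]; exact ht
  have ht₂0 : 0 ≤ t₂ := Real.sqrt_nonneg _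
  have ht₂1 : t₂ ≤ 1 := by rw [ht₂, Real.sqrt_le_one]; exact hx1
  have ht₁0 : 0 ≤ t₁ := Real.sqrt_nonneg _
  have ht₁1 : t₁ ≤ 1 := by rw [ht₁, Real.sqrt_le_one]; exact ht₂1
  have h12 : t₁ ^ 2 ≤ t₂ := by rw [ht₁, Real.sq_sqrt ht₂0]
  have hbox := ballVol_pow_le_ringMeasure_real_deficit_le (L := L) ht₁0 ht₁1 ht₂0 h12
  have hts : 400 * (L : ℝ) ^ 4 * t₂ ^ 2 = t := by
    rw [ht₂, Real.sq_sqrt (div_nonneg ht0.le hK.le)]; field_simp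
  rw [hts] at hbox
  refine le_trans ?_ hbox
  have h1 : t₁ ^ 3 / 34 ≤ ballVol t₁ := pow_three_div_le_ballVol ht₁0 (by linarith)
  have h2 : t₂ ^ 3 / 34 ≤ ballVol t₂ := pow_three_div_le_ballVol ht₂0 (by linarith)
  have h3 : 3 ≤ 6 * L ^ 4 := by nlinarith [Nat.one_le_pow 4 L hL1]
  have e : (6 * L ^ 4 + 1) = 4 + (6 * L ^ 4 - 3) := by omega
  have e2 : (t₁ ^ 3 / 34) ^ 4 * (t₂ ^ 3 / 34) ^ (6 * L ^ 4 - 3) =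
      (1 / 34 : ℝ) ^ (6 * L ^ 4 + 1) * ((t₁ ^ 3) ^ 4 * (t₂ ^ 3) ^ (6 * L ^ 4 - 3)) := by
    rw [div_pow, div_pow, e, pow_add, one_div, inv_pow, inv_pow]
    field_simp
  calc (1 / 34 : ℝ) ^ (6 * L ^ 4 + 1) * (t / (400 * (L : ℝ) ^ 4)) ^ (9 * (L : ℝ) ^ 4 - 3 / 2)
      = (t₁ ^ 3 / 34) ^ 4 * (t₂ ^ 3 / 34) ^ (6 * L ^ 4 - 3) := by
        rw [e2, ← pow_count hK ht0.le hL1, ← ht₂, ← ht₁]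
    _ ≤ ballVol t₁ ^ 4 * ballVol t₂ ^ (6 * L ^ 4 - 3) := by
        gcongr

/-- ★★ **SHARP PERIODIC VOLUME FLOOR, `∃`-form**: for every `L ≥ 1` there is `c > 0` with `c · t^{9L⁴−3/2} ≤ (ringMeasure L).real {F₀ ≤ t}` for all
`0 < t ≤ 1`. [cite: Luscher1983, §2] [cite: Vanbaal2001] -/
theorem exists_sharp_volume_floor (L : ℕ) [NeZero L] :
    ∃ c : ℝ, 0 < c ∧ ∀ t : ℝ, 0 < t → t ≤ 1 →
      c * t ^ (9 * (L : ℝ) ^ 4 - 3 / 2) ≤ (ringMeasure L).real {P | ringDeficit L (fun _ => false) P ≤ t} := by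
  have hL : (0 : ℝ) < L := by exact_mod_cast NeZero.pos L
  have hK : (0 : ℝ) < 400 * (L : ℝ) ^ 4 := by positivity
  have hK1 : (1 : ℝ) ≤ 400 * (L : ℝ) ^ 4 := by
    have : (1 : ℝ) ≤ (L : ℝ) ^ 4 := one_le_pow₀ (by exact_mod_cast NeZero.one_le)
    linarith
  refine ⟨(1 / 34 : ℝ) ^ (6 * L ^ 4 + 1) * (400 * (L : ℝ) ^ 4) ^ (-(9 * (L : ℝ) ^ 4 - 3 / 2)), by positivity,
    fun t ht0 ht1 => ?_⟩
  have h := sharp_volume_floor (L := L) ht0 (ht1.trans hK1)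
  rw [Real.div_rpow ht0.le hK.le, div_eq_mul_inv (t ^ (9 * (L : ℝ) ^ 4 - 3 / 2)), ← Real.rpow_neg hK.le] at h
  linarith [h, le_of_eq (by ring : (1 / 34 : ℝ) ^ (6 * L ^ 4 + 1) * (400 * (L : ℝ) ^ 4) ^ (-(9 * (L : ℝ) ^ 4 - 3 / 2)) *
    t ^ (9 * (L : ℝ) ^ 4 - 3 / 2) = (1 / 34 : ℝ) ^ (6 * L ^ 4 + 1) * (t ^ (9 * (L : ℝ) ^ 4 - 3 / 2) *
    (400 * (L : ℝ) ^ 4) ^ (-(9 * (L : ℝ) ^ 4 - 3 / 2))))]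

/-- ★★ **SHARP PERIODIC LAPLACE FLOOR**: for `β ≥ 1`,
`e^{−1}·(1/34)^{6L⁴+1}·(400L⁴β)^{−(9L⁴−3/2)} ≤ ∫ e^{−βF₀} dμ_L` (`e^{−βF₀} ≥ e^{−1}` on `{F₀ ≤ 1/β}`). [cite: Luscher1983, §2] -/
theorem sharp_laplace_floor {β : ℝ} (hβ : 1 ≤ β) :
    Real.exp (-1) * ((1 / 34 : ℝ) ^ (6 * L ^ 4 + 1) * (400 * (L : ℝ) ^ 4 * β) ^ (-(9 * (L : ℝ) ^ 4 - 3 / 2))) ≤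
      ∫ P, Real.exp (-(β * ringDeficit L (fun _ => false) P)) ∂(ringMeasure L) := by
  haveI := isProbabilityMeasure_ringMeasure (L := L)
  have hβ0 : 0 < β := by linarith
  have hL : (0 : ℝ) < L := by exact_mod_cast NeZero.pos L
  have hK : (0 : ℝ) < 400 * (L : ℝ) ^ 4 := by positivity
  have hK1 : (1 : ℝ) ≤ 400 * (L : ℝ) ^ 4 := by
    have : (1 : ℝ) ≤ (L : ℝ) ^ 4 := one_le_pow₀ (by exact_mod_cast NeZero.one_le)
    linarith
  set S : Set ((Fin (2 * L - 1 + 1) → GaugeConfig 3 L SU2) × (Site 3 L → SU2)) :=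
    {P | ringDeficit L (fun _ => false) P ≤ 1 / β} with hS
  have hSm : MeasurableSet S := measurableSet_le (measurable_ringDeficit _) measurable_const
  -- the volume floor at `t = 1/β`
  have hvol := sharp_volume_floor (L := L) (t := 1 / β) (by positivity) ((div_le_one hβ0).2 hβ |>.trans hK1)
  have hrew : (1 / β / (400 * (L : ℝ) ^ 4)) ^ (9 * (L : ℝ) ^ 4 - 3 / 2) = (400 * (L : ℝ) ^ 4 * β) ^ (-(9 * (L : ℝ) ^ 4 - 3 / 2)) := by
    rw [Real.rpow_neg (by positivity), ← Real.inv_rpow (by positivity)]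
    congr 1; field_simp
  rw [hrew] at hvol
  -- `e^{-1} 𝟙_S ≤ e^{-βF₀}`
  have hind : ∀ P, S.indicator (fun _ => Real.exp (-1)) P ≤ Real.exp (-(β * ringDeficit L (fun _ => false) P)) := by
    intro P
    by_cases hP : P ∈ S
    · rw [Set.indicator_of_mem hP, Real.exp_le_exp]
      have h : β * ringDeficit L (fun _ => false) P ≤ β * (1 / β) := mul_le_mul_of_nonneg_left hP hβ0.le
      rw [mul_one_div_cancel hβ0.ne'] at h
      linarith
    · rw [Set.indicator_of_notMem hP]; exact (Real.exp_pos _).le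
  calc Real.exp (-1) * ((1 / 34 : ℝ) ^ (6 * L ^ 4 + 1) * (400 * (L : ℝ) ^ 4 * β) ^ (-(9 * (L : ℝ) ^ 4 - 3 / 2)))
      ≤ Real.exp (-1) * (ringMeasure L).real S := mul_le_mul_of_nonneg_left hvol (Real.exp_pos _).le
    _ = ∫ P, S.indicator (fun _ => Real.exp (-1)) P ∂(ringMeasure L) := by
        rw [integral_indicator_const _ hSm, smul_eq_mul, mul_comm]
    _ ≤ ∫ P, Real.exp (-(β * ringDeficit L (fun _ => false) P)) ∂(ringMeasure L) :=
        integral_mono ((integrable_const _).indicator hSm) (integrable_exp_neg_mul_ringDeficit β _) hind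

/-- ★★ **SHARP PERIODIC FLOOR OF THE ZERO-FLUX THERMAL TRACE AT EVERY FIXED `L`**: for `β ≥ 1`,
`(1/8)·e^{12βL⁴}·e^{−1}(1/34)^{6L⁴+1}(400L⁴β)^{−(9L⁴−3/2)} ≤ TT.physTrace L β (2L)` — the zero-flux trace is `(1/8)Σ_z W_z` over the eight electric-flux
sectors (✓`physTraceSucc_eq_sum_sectorWeight`), the seven twisted ones are `≥ 0`, and `W_0(β) = e^{12βL⁴}∫e^{−βF₀}dμ_L`
(✓`sectorWeight_eq_exp_mul_integral_deficit`).  The CEILING of the same order for the swap-twisted trace, which ⟨23802⟩ would also need at small `L`, is NOT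
proved here. [cite: Luscher1983, §2] [cite: MontvayMunster1994, (3.145)] -/
theorem sharp_physTrace_floor {β : ℝ} (hβ : 1 ≤ β) :
    (1 / 8 : ℝ) * Real.exp (12 * β * (L : ℝ) ^ 4) *
        (Real.exp (-1) * ((1 / 34 : ℝ) ^ (6 * L ^ 4 + 1) * (400 * (L : ℝ) ^ 4 * β) ^ (-(9 * (L : ℝ) ^ 4 - 3 / 2)))) ≤
      TT.physTrace L β (2 * L) := by
  have hlap := sharp_laplace_floor (L := L) hβ
  have hW0 := sectorWeight_eq_exp_mul_integral_deficit (L := L) β (fun _ => false)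
  have hsum := physTraceSucc_eq_sum_sectorWeight (L := L) β (2 * L - 1)
  have hphys : TT.physTrace L β (2 * L) = physTraceSucc L β (2 * L - 1) := rfl
  rw [hphys, hsum]
  have hle : sectorWeight (L := L) β (2 * L - 1) (fun _ => false) (fun _ _ => (1 : ℝ)) ≤
      ∑ z : Fin 3 → Bool, sectorWeight (L := L) β (2 * L - 1) z fun _ _ => (1 : ℝ) :=
    Finset.single_le_sum (f := fun z : Fin 3 → Bool => sectorWeight (L := L) β (2 * L - 1) z fun _ _ => (1 : ℝ))
      (fun z _ => sectorWeight_nonneg β _ z (fun _ _ => zero_le_one)) (Finset.mem_univ _)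
  calc (1 / 8 : ℝ) * Real.exp (12 * β * (L : ℝ) ^ 4) *
        (Real.exp (-1) * ((1 / 34 : ℝ) ^ (6 * L ^ 4 + 1) * (400 * (L : ℝ) ^ 4 * β) ^ (-(9 * (L : ℝ) ^ 4 - 3 / 2))))
      ≤ (1 / 8 : ℝ) * (Real.exp (12 * β * (L : ℝ) ^ 4) * ∫ P, Real.exp (-(β * ringDeficit L (fun _ => false) P)) ∂(ringMeasure L)) := by
        rw [mul_assoc]
        exact mul_le_mul_of_nonneg_left (mul_le_mul_of_nonneg_left hlap (Real.exp_pos _).le) (by norm_num)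
    _ = (1 / 8 : ℝ) * sectorWeight (L := L) β (2 * L - 1) (fun _ => false) (fun _ _ => (1 : ℝ)) := by rw [hW0]
    _ ≤ (1 / 8 : ℝ) * ∑ z : Fin 3 → Bool, sectorWeight (L := L) β (2 * L - 1) z fun _ _ => (1 : ℝ) :=
        mul_le_mul_of_nonneg_left hle (by norm_num)

end Summit.QuantumFields.YangMills.Theorems.SwapTwistDeficit.PeriodicRingFloor

end
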